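import Summits.CriticalPhenomena.PercolationContinuityZ3.Theorems.PercNearOneGluingNoHeavyPcintNawFreeZ4F12Defs
import HarnessLib

/-!
# PCINT lane, kernel reduced-state B2d (`nawfree`) certificate `Z4F12` (d = 4, memory τ = 12, delay kt = 4, 12932 state classes): row checks 21 (rows [6000, 6300))

Cell `prim-pcint`, seat `prim-pcint-1` (gen 7); memo `run/shared/lean/prim/pcint/REDUCTIONS.md` §B2d (delayed chain payments with
free-neighbour shares).  Does NOT build on p205010.  Data for `NawK.le_siteCriticalProb_of_checkRowsF` (`…PcintNawFreeMemKernelCert`):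
`p = 17090/100000`, weight table `Q_k/100000`, `Q = [82910, 82910, 91055, 93944, 95423, 96322, 96925, 97359, 97685]` (`Q_k^k·100000 ≥ (100000-17090)·100000^k`, nondecreasing), `λ = 99999/100000`; Collatz–Wielandt
weights (scale 10⁹) from a power iteration, exact off-line max row ratio 0.9994858418 < λ.  Generated by work/gen6/gen_free.py
(pcint-1 gen 6; run by gen 7); the kernel re-checks every row.
-/

namespace Summit.CriticalPhenomena.PercolationContinuityZ3.Theorems.Pcint.NawFreeZ4F12

set_option maxHeartbeats 0 in
/-- Rows `[6000, 6050)` pass the check. [folklore] -/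
theorem chk_6000 : WinK.allRange (NawK.checkRowF 12 4 4 12932 17090 100000 99999 100000 NawFreeZ4F12.QL NawFreeZ4F12.syms NawFreeZ4F12.tree) 6000 6050 = true :=
  WinK.allRange_of_allRangeB (fuel := 8) (lo := 6000) (len := 50) (by decide +kernel)

set_option maxHeartbeats 0 in
/-- Rows `[6050, 6100)` pass the check. [folklore] -/
theorem chk_6050 : WinK.allRange (NawK.checkRowF 12 4 4 12932 17090 100000 99999 100000 NawFreeZ4F12.QL NawFreeZ4F12.syms NawFreeZ4F12.tree) 6050 6100 = true :=
  WinK.allRange_of_allRangeB (fuel := 8) (lo := 6050) (len := 50) (by decide +kernel)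

set_option maxHeartbeats 0 in
/-- Rows `[6100, 6150)` pass the check. [folklore] -/
theorem chk_6100 : WinK.allRange (NawK.checkRowF 12 4 4 12932 17090 100000 99999 100000 NawFreeZ4F12.QL NawFreeZ4F12.syms NawFreeZ4F12.tree) 6100 6150 = true :=
  WinK.allRange_of_allRangeB (fuel := 8) (lo := 6100) (len := 50) (by decide +kernel)

set_option maxHeartbeats 0 in
/-- Rows `[6150, 6200)` pass the check. [folklore] -/
theorem chk_6150 : WinK.allRange (NawK.checkRowF 12 4 4 12932 17090 100000 99999 100000 NawFreeZ4F12.QL NawFreeZ4F12.syms NawFreeZ4F12.tree) 6150 6200 = true :=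
  WinK.allRange_of_allRangeB (fuel := 8) (lo := 6150) (len := 50) (by decide +kernel)

set_option maxHeartbeats 0 in
/-- Rows `[6200, 6250)` pass the check. [folklore] -/
theorem chk_6200 : WinK.allRange (NawK.checkRowF 12 4 4 12932 17090 100000 99999 100000 NawFreeZ4F12.QL NawFreeZ4F12.syms NawFreeZ4F12.tree) 6200 6250 = true :=
  WinK.allRange_of_allRangeB (fuel := 8) (lo := 6200) (len := 50) (by decide +kernel)

set_option maxHeartbeats 0 in
/-- Rows `[6250, 6300)` pass the check. [folklore] -/
theorem chk_6250 : WinK.allRange (NawK.checkRowF 12 4 4 12932 17090 100000 99999 100000 NawFreeZ4F12.QL NawFreeZ4F12.syms NawFreeZ4F12.tree) 6250 6300 = true :=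
  WinK.allRange_of_allRangeB (fuel := 8) (lo := 6250) (len := 50) (by decide +kernel)

/-- Rows `[6000, 6300)` pass the check. [folklore] -/
theorem file_21 : WinK.allRange (NawK.checkRowF 12 4 4 12932 17090 100000 99999 100000 NawFreeZ4F12.QL NawFreeZ4F12.syms NawFreeZ4F12.tree) 6000 6300 = true := (WinK.allRange_split (WinK.allRange_split (WinK.allRange_split (WinK.allRange_split (WinK.allRange_split chk_6000 chk_6050) chk_6100) chk_6150) chk_6200) chk_6250)

end Summit.CriticalPhenomena.PercolationContinuityZ3.Theorems.Pcint.NawFreeZ4F12
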